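import Literature.MathematicalPhysics.KineticTheory.ReyBelletThomas2002Semigroup
import Literature.MathematicalPhysics.KineticTheory.ReyBelletThomas2002ExpBound
import Literature.MathematicalPhysics.KineticTheory.LangevinChainEnergyIdentity
import HarnessLib

/-!
# Rey-Bellet–Thomas 2002: the pathwise energy identity of the reservoir-driven chain

Trunk T-KINETIC (Literature/MathematicalPhysics/KineticTheory). First step towards Theorem 3.10 of
Rey-Bellet–Thomas (the Liapunov bound (39)) for the named fact `ReyBelletThomas2002_thm21`
(provefact unit): the identity behind eq. (40) of the paper, "Using Itô's formula to compute
`G(x(s)) - G(x)` in terms of a stochastic integral: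
`G(x(s)) - G(x) = γ Tr(T) s - ∫₀ˢ γ r² dt + ∫₀ˢ √(2γT) r dω`", here PATH BY PATH for the flow
`z = rbFlow x η` of (RBT-SDE) driven through the reservoirs by an arbitrary CONTINUOUS noise path
`η = (η_L, η_R)` (`z(t) = x + (0, η(t)) + ∫₀ᵗ Y(z)`, `Y = rbDrift`; the model-specific twin of
`LangevinChainEnergyIdentity.lean`, where the noise drives the momenta):

* `OscillatorChain.fderiv_rbEnergy_rbDrift_eq` — the exact algebra
  `DG(y)·Y(y + (0,e)) = -(e_L Y(y+(0,e))_{r_L} + e_R Y(y+(0,e))_{r_R}) - γ ((r_L+e_L)² + (r_R+e_R)²)`;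
* `OscillatorChain.rbFlow`, `rbDissipation`, `rbNoiseWork` — the flow, the **dissipation
  functional** `Γ_t = γ ∫₀ᵗ (r_L² + r_R²)` and the **work of the noise**
  `𝓜_t = ∑_b ((r_b(t) - η_b(t)) η_b(t) - ∫₀ᵗ η_b Y(z)_{r_b} + η_b(t)²/2)` (for the Brownian noise
  `η_b = √(2γT_b) ω_b` this is the Itô integral `∫ √(2γT) r dω` plus its compensator `γ Tr(T) t`);
* `OscillatorChain.rbEnergy_rbFlow_eq` — **`G(z(t)) = G(x) + 𝓜_t - Γ_t`** for `t ≥ 0`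
  (chain rule for `G ∘ (z - (0,η))`, fundamental theorem of calculus; no probability);
* `rbDissipation_mono/nonneg/add` — monotonicity and the cocycle additivity of `Γ`;
* measurability of `Γ` and `𝓜` in a measurably parametrised start and noise path.

## References

* L. Rey-Bellet, L. E. Thomas, Comm. Math. Phys. **225** (2002) 305–329, Lemma 3.5 (28),
  Thm 3.10 eq. (40).
* N. Cuneo, J.-P. Eckmann, M. Hairer, L. Rey-Bellet, EJP **23** (2018) no. 55, Lemma 5.5 (proof)
  (the same pathwise bookkeeping for Langevin baths).
-/

noncomputable section

open MeasureTheory Filter Topology Set Metric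
open scoped NNReal

namespace Literature.MathematicalPhysics.KineticTheory.HeatConduction

open Literature.Analysis.ODE Literature.MathematicalPhysics.KineticTheory

variable {N : ℕ}

namespace OscillatorChain

variable (P : OscillatorChain)

/-! ### The exact energy identity for the drift -/

variable {P} in
/-- **The energy identity, exact form**: for the drift `Y` of (RBT-SDE) and a reservoir
perturbation `e`, `DG(y)·Y(y + (0, e)) = -(e_L Y(y+(0,e))_{r_L} + e_R Y(y+(0,e))_{r_R}) -
γ ((r_L + e_L)² + (r_R + e_R)²)`. [cite: ReyBelletThomas2002, Lemma 3.5] -/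
theorem fderiv_rbEnergy_rbDrift_eq (hH : Differentiable ℝ (P.hamiltonian N)) (Λ : ℝ)
    (y : RBPhaseSpace N) (e : ℝ × ℝ) :
    fderiv ℝ (P.rbEnergy N) y (P.rbDrift Λ N (y + ((0 : PhaseSpace N), e))) =
      -(e.1 * (P.rbDrift Λ N (y + ((0 : PhaseSpace N), e))).2.1 +
          e.2 * (P.rbDrift Λ N (y + ((0 : PhaseSpace N), e))).2.2) -
        P.γ * ((y.2.1 + e.1) ^ 2 + (y.2.2 + e.2) ^ 2) := by
  rw [P.fderiv_rbEnergy_rbDrift hH]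
  have hz1 : (y + (((0 : PhaseSpace N), e) : RBPhaseSpace N)).1 = y.1 := by simp
  have hz21 : (y + (((0 : PhaseSpace N), e) : RBPhaseSpace N)).2.1 = y.2.1 + e.1 := by simp
  have hz22 : (y + (((0 : PhaseSpace N), e) : RBPhaseSpace N)).2.2 = y.2.2 + e.2 := by simp
  simp only [rbDrift, hz1, hz21, hz22]
  ring

/-! ### The flow driven through the reservoirs, and the two path functionals -/

/-- The **flow of (RBT-SDE) driven by a reservoir noise path** `η = (η_L, η_R)`:
`z(t) = x + (0, η(t)) + ∫₀ᵗ Y(z)`. [cite: ReyBelletThomas2002, §2 eq. (12)] -/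
def rbFlow (Λ : ℝ) (N : ℕ) (x : RBPhaseSpace N) (η : ℝ → ℝ × ℝ) : ℝ → RBPhaseSpace N :=
  drivenFlow (P.rbDrift Λ N) x fun t => ((0 : PhaseSpace N), η t)

/-- The **dissipation functional** `Γ_t = γ ∫₀ᵗ (r_L(s)² + r_R(s)²) ds` along the flow
(`d/dt G = -γ r²` for the undriven dynamics (18)). [cite: ReyBelletThomas2002, Thm 3.10 eq. (40)] -/
def rbDissipation (Λ : ℝ) (N : ℕ) (x : RBPhaseSpace N) (η : ℝ → ℝ × ℝ) (t : ℝ) : ℝ :=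
  P.γ * ∫ s in (0 : ℝ)..t, ((P.rbFlow Λ N x η s).2.1 ^ 2 + (P.rbFlow Λ N x η s).2.2 ^ 2)

/-- The **work of the noise** `𝓜_t = ∑_b ((r_b(t) - η_b(t)) η_b(t) - ∫₀ᵗ η_b(s) Y(z(s))_{r_b} ds +
η_b(t)²/2)` — the pathwise form of `∫₀ᵗ √(2γT) r dω + γ Tr(T) t`. [cite: ReyBelletThomas2002, Thm 3.10 eq. (40)] -/
def rbNoiseWork (Λ : ℝ) (N : ℕ) (x : RBPhaseSpace N) (η : ℝ → ℝ × ℝ) (t : ℝ) : ℝ :=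
  (((P.rbFlow Λ N x η t).2.1 - (η t).1) * (η t).1 -
      (∫ s in (0 : ℝ)..t, (η s).1 * (P.rbDrift Λ N (P.rbFlow Λ N x η s)).2.1) + (η t).1 ^ 2 / 2) +
    (((P.rbFlow Λ N x η t).2.2 - (η t).2) * (η t).2 -
      (∫ s in (0 : ℝ)..t, (η s).2 * (P.rbDrift Λ N (P.rbFlow Λ N x η s)).2.2) + (η t).2 ^ 2 / 2)

/-- `Γ_0 = 0`. [folklore] -/
@[simp] theorem rbDissipation_zero (Λ : ℝ) (N : ℕ) (x : RBPhaseSpace N) (η : ℝ → ℝ × ℝ) :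
    P.rbDissipation Λ N x η 0 = 0 := by
  simp [rbDissipation]

/-- The reservoir noise path `(0, η)` lies in the reservoir subspace. [folklore] -/
theorem zero_prod_apply_mem_rbNoise (η : ℝ → ℝ × ℝ) (t : ℝ) :
    (((0 : PhaseSpace N), η t) : RBPhaseSpace N) ∈ rbNoise N :=
  zero_prod_mem_rbNoise _

/-- The reservoir noise path is continuous for a continuous `η`. [folklore] -/
theorem continuous_zero_prod {η : ℝ → ℝ × ℝ} (hη : Continuous η) :
    Continuous fun t => (((0 : PhaseSpace N), η t) : RBPhaseSpace N) :=
  continuous_const.prodMk hη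

end OscillatorChain

/-! ### The energy identity along the flow -/

section Identity

variable {P : OscillatorChain} {k₁ k₂ : ℝ} (hU : RBGrowth P.U k₁) (hV : RBGrowth P.V k₂)
  (hk₁ : 1 ≤ k₁) (hk₂ : 1 ≤ k₂) (hγ : 0 ≤ P.γ) (Λ : ℝ) (N : ℕ)
include hU hV hk₁ hk₂ hγ

namespace OscillatorChain

/-- The flow is continuous in time. [folklore] -/
theorem continuous_rbFlow (x : RBPhaseSpace N) {η : ℝ → ℝ × ℝ} (hη : Continuous η) :
    Continuous (P.rbFlow Λ N x η) :=
  (P.rbConfinedDrift hU hV hk₁ hk₂ hγ Λ N).continuous_flow x (continuous_zero_prod hη)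
    (zero_prod_apply_mem_rbNoise η)

/-- The flow solves the integral equation on every `[0, T]`. [folklore] -/
theorem isIntegralSolutionOn_rbFlow (x : RBPhaseSpace N) {η : ℝ → ℝ × ℝ} (hη : Continuous η)
    (T : ℝ) : IsIntegralSolutionOn (P.rbDrift Λ N) (fun t => x + ((0 : PhaseSpace N), η t))
      (P.rbFlow Λ N x η) T :=
  (P.rbConfinedDrift hU hV hk₁ hk₂ hγ Λ N).isIntegralSolutionOn_flow x (continuous_zero_prod hη)
    (zero_prod_apply_mem_rbNoise η) T

/-- **The cocycle property** of the flow: for `s, t ≥ 0`,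
`z_{x,η}(s + t) = z_{z(s), η(s+·) - η(s)}(t)`. [folklore] -/
theorem rbFlow_add (x : RBPhaseSpace N) {η : ℝ → ℝ × ℝ} (hη : Continuous η) {s t : ℝ}
    (hs : 0 ≤ s) (ht : 0 ≤ t) :
    P.rbFlow Λ N x η (s + t) = P.rbFlow Λ N (P.rbFlow Λ N x η s) (fun r => η (s + r) - η s) t := by
  have h := (P.rbConfinedDrift hU hV hk₁ hk₂ hγ Λ N).flow_add x (continuous_zero_prod hη)
    (zero_prod_apply_mem_rbNoise η) hs ht
  unfold rbFlow
  rw [h]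
  congr 1
  funext r
  ext <;> simp

/-- **The pathwise energy identity** (RBT (40) path by path; CEHR Lemma 5.5): for the flow of
(RBT-SDE) driven by a continuous reservoir noise path `η` and `t ≥ 0`,
`G(z(t)) = G(x) + 𝓜_t - Γ_t`. Proof: `y = z - (0, η)` is `C¹` with `y' = Y(z)`;
`G(z) = G(y) + r_y·η + |η|²/2`; `(G∘y)' = DG(y)·Y(y + (0,η)) = -η·Y(z)_r - γ|r_z|²`; integrate.
[cite: ReyBelletThomas2002, Thm 3.10 eq. (40)] -/
theorem rbEnergy_rbFlow_eq (x : RBPhaseSpace N) {η : ℝ → ℝ × ℝ} (hη : Continuous η) {t : ℝ}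
    (ht : 0 ≤ t) :
    P.rbEnergy N (P.rbFlow Λ N x η t) =
      P.rbEnergy N x + P.rbNoiseWork Λ N x η t - P.rbDissipation Λ N x η t := by
  set G := P.rbEnergy N with hGdef
  set Y := P.rbDrift Λ N with hYdef
  set z := P.rbFlow Λ N x η with hzdef
  have hH : Differentiable ℝ (P.hamiltonian N) :=
    (P.contDiff_hamiltonian hU.1 hV.1 N).differentiable (by simp)
  have hYc : Continuous Y := (P.contDiff_rbDrift hU.1 hV.1 Λ N).continuous
  have hzc : Continuous z := continuous_rbFlow hU hV hk₁ hk₂ hγ Λ N x hη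
  have hz_eq : ∀ s ∈ Icc 0 t, z s = (x + ((0 : PhaseSpace N), η s)) + ∫ r in (0 : ℝ)..s, Y (z r) :=
    isIntegralSolutionOn_rbFlow hU hV hk₁ hk₂ hγ Λ N x hη t
  have hGs : ContDiff ℝ 1 G := (P.contDiff_rbEnergy hU.1 hV.1 N).of_le (by norm_cast)
  have hGd : Differentiable ℝ G := hGs.differentiable one_ne_zero
  have hGfc : Continuous (fderiv ℝ G) := hGs.continuous_fderiv one_ne_zero
  -- `y(s) = x + ∫₀ˢ Y(z)`, `y' = Y(z)`, `y = z - (0, η)` on `[0, t]`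
  set y : ℝ → RBPhaseSpace N := fun s => x + ∫ r in (0 : ℝ)..s, Y (z r) with hydef
  have hy_deriv : ∀ s, HasDerivAt y (Y (z s)) s := fun s => by
    have h1 : HasDerivAt (fun u => ∫ r in (0 : ℝ)..u, Y (z r)) (Y (z s)) s :=
      ((hYc.comp hzc).integral_hasStrictDerivAt 0 s).hasDerivAt
    exact h1.const_add x
  have hyc : Continuous y := continuous_iff_continuousAt.2 fun s => (hy_deriv s).continuousAt
  have hy_eq : ∀ s ∈ Icc 0 t, y s = z s - ((0 : PhaseSpace N), η s) := fun s hs => by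
    rw [hz_eq s hs]
    simp only [hydef]
    abel
  have hz_y : ∀ s ∈ Icc 0 t, z s = y s + ((0 : PhaseSpace N), η s) := fun s hs => by
    rw [hy_eq s hs]; abel
  have hy0 : y 0 = x := by simp [hydef]
  -- the chain rule for `G ∘ y` and the fundamental theorem of calculus
  have hg_deriv : ∀ s, HasDerivAt (fun s => G (y s)) (fderiv ℝ G (y s) (Y (z s))) s := fun s =>
    (hGd (y s)).hasFDerivAt.comp_hasDerivAt s (hy_deriv s)
  have hg_cont : Continuous fun s => fderiv ℝ G (y s) (Y (z s)) :=
    (hGfc.comp hyc).clm_apply (hYc.comp hzc)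
  have hFTC : ∫ s in (0 : ℝ)..t, fderiv ℝ G (y s) (Y (z s)) = G (y t) - G x := by
    rw [intervalIntegral.integral_eq_sub_of_hasDerivAt (fun s _ => hg_deriv s)
      (hg_cont.intervalIntegrable _ _), hy0]
  -- the integrand on `[0, t]`
  have hintegrand : ∀ s ∈ uIcc 0 t, fderiv ℝ G (y s) (Y (z s)) =
      -((η s).1 * (Y (z s)).2.1 + (η s).2 * (Y (z s)).2.2) -
        P.γ * ((z s).2.1 ^ 2 + (z s).2.2 ^ 2) := by
    intro s hs
    rw [uIcc_of_le ht] at hs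
    have h := fderiv_rbEnergy_rbDrift_eq hH Λ (y s) (η s)
    rw [← hz_y s hs] at h
    rw [h]
    have e1 : (y s).2.1 + (η s).1 = (z s).2.1 := by rw [hz_y s hs]; simp
    have e2 : (y s).2.2 + (η s).2 = (z s).2.2 := by rw [hz_y s hs]; simp
    rw [e1, e2]
  have hηc1 : Continuous fun s => (η s).1 := continuous_fst.comp hη
  have hηc2 : Continuous fun s => (η s).2 := continuous_snd.comp hη
  have hYz1 : Continuous fun s => (Y (z s)).2.1 := continuous_fst.comp (continuous_snd.comp (hYc.comp hzc))
  have hYz2 : Continuous fun s => (Y (z s)).2.2 := continuous_snd.comp (continuous_snd.comp (hYc.comp hzc))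
  have hz1c : Continuous fun s => (z s).2.1 := continuous_fst.comp (continuous_snd.comp hzc)
  have hz2c : Continuous fun s => (z s).2.2 := continuous_snd.comp (continuous_snd.comp hzc)
  have hI1 : IntervalIntegrable (fun s => (η s).1 * (Y (z s)).2.1) volume 0 t :=
    (hηc1.mul hYz1).intervalIntegrable _ _
  have hI2 : IntervalIntegrable (fun s => (η s).2 * (Y (z s)).2.2) volume 0 t :=
    (hηc2.mul hYz2).intervalIntegrable _ _
  have hI3 : IntervalIntegrable (fun s => (z s).2.1 ^ 2 + (z s).2.2 ^ 2) volume 0 t :=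
    ((hz1c.pow 2).add (hz2c.pow 2)).intervalIntegrable _ _
  have hsplit : ∫ s in (0 : ℝ)..t, fderiv ℝ G (y s) (Y (z s)) =
      -((∫ s in (0 : ℝ)..t, (η s).1 * (Y (z s)).2.1) + ∫ s in (0 : ℝ)..t, (η s).2 * (Y (z s)).2.2) -
        P.γ * ∫ s in (0 : ℝ)..t, ((z s).2.1 ^ 2 + (z s).2.2 ^ 2) := by
    have hA : IntervalIntegrable (fun s => -((η s).1 * (Y (z s)).2.1 + (η s).2 * (Y (z s)).2.2))
        volume 0 t := (hI1.add hI2).neg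
    have hB : IntervalIntegrable (fun s => P.γ * ((z s).2.1 ^ 2 + (z s).2.2 ^ 2)) volume 0 t :=
      hI3.const_mul _
    rw [intervalIntegral.integral_congr hintegrand, intervalIntegral.integral_sub hA hB,
      intervalIntegral.integral_neg, intervalIntegral.integral_add hI1 hI2,
      intervalIntegral.integral_const_mul]
  -- `G(z t) = G(y t) + r_y·η + |η|²/2`
  have hGz : G (z t) = G (y t) + ((y t).2.1 * (η t).1 + (y t).2.2 * (η t).2 +
      ((η t).1 ^ 2 + (η t).2 ^ 2) / 2) := by
    rw [hz_y t ⟨ht, le_rfl⟩]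
    have := P.rbEnergy_add_zero_prod N (y t) (η t)
    simp only [hGdef] at this ⊢
    linarith
  have hA1 : (y t).2.1 = (z t).2.1 - (η t).1 := by rw [hy_eq t ⟨ht, le_rfl⟩]; simp
  have hA2 : (y t).2.2 = (z t).2.2 - (η t).2 := by rw [hy_eq t ⟨ht, le_rfl⟩]; simp
  -- assemble
  have hW : P.rbNoiseWork Λ N x η t = (((z t).2.1 - (η t).1) * (η t).1 -
      (∫ s in (0 : ℝ)..t, (η s).1 * (Y (z s)).2.1) + (η t).1 ^ 2 / 2) +
      (((z t).2.2 - (η t).2) * (η t).2 -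
      (∫ s in (0 : ℝ)..t, (η s).2 * (Y (z s)).2.2) + (η t).2 ^ 2 / 2) := rfl
  have hD : P.rbDissipation Λ N x η t = P.γ * ∫ s in (0 : ℝ)..t, ((z s).2.1 ^ 2 + (z s).2.2 ^ 2) := rfl
  rw [hW, hD, hGz, hA1, hA2]
  linarith [hFTC, hsplit]

/-- The dissipation functional is nondecreasing in time (`γ ≥ 0`). [folklore] -/
theorem rbDissipation_mono (x : RBPhaseSpace N) {η : ℝ → ℝ × ℝ} (hη : Continuous η) {s t : ℝ}
    (hst : s ≤ t) : P.rbDissipation Λ N x η s ≤ P.rbDissipation Λ N x η t := by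
  unfold rbDissipation
  have hzc := continuous_rbFlow hU hV hk₁ hk₂ hγ Λ N x hη
  have hc : Continuous fun r => (P.rbFlow Λ N x η r).2.1 ^ 2 + (P.rbFlow Λ N x η r).2.2 ^ 2 :=
    ((continuous_fst.comp (continuous_snd.comp hzc)).pow 2).add
      ((continuous_snd.comp (continuous_snd.comp hzc)).pow 2)
  have hnn : ∀ r, 0 ≤ (P.rbFlow Λ N x η r).2.1 ^ 2 + (P.rbFlow Λ N x η r).2.2 ^ 2 := fun r => by
    positivity
  refine mul_le_mul_of_nonneg_left ?_ hγ
  rw [← intervalIntegral.integral_add_adjacent_intervals (hc.intervalIntegrable 0 s)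
    (hc.intervalIntegrable s t)]
  have : 0 ≤ ∫ r in s..t, ((P.rbFlow Λ N x η r).2.1 ^ 2 + (P.rbFlow Λ N x η r).2.2 ^ 2) :=
    intervalIntegral.integral_nonneg hst fun r _ => hnn r
  linarith

/-- `Γ_t ≥ 0` for `t ≥ 0` (`γ ≥ 0`). [folklore] -/
theorem rbDissipation_nonneg (x : RBPhaseSpace N) {η : ℝ → ℝ × ℝ} (hη : Continuous η) {t : ℝ}
    (ht : 0 ≤ t) : 0 ≤ P.rbDissipation Λ N x η t := by
  have h := rbDissipation_mono hU hV hk₁ hk₂ hγ Λ N x hη ht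
  rwa [rbDissipation_zero] at h

/-- **Additivity of the dissipation along the cocycle**: for `s, t ≥ 0`,
`Γ_{s+t}(x, η) = Γ_s(x, η) + Γ_t(z(s), η(s + ·) - η(s))`. [folklore] -/
theorem rbDissipation_add (x : RBPhaseSpace N) {η : ℝ → ℝ × ℝ} (hη : Continuous η) {s t : ℝ}
    (hs : 0 ≤ s) (ht : 0 ≤ t) :
    P.rbDissipation Λ N x η (s + t) =
      P.rbDissipation Λ N x η s +
        P.rbDissipation Λ N (P.rbFlow Λ N x η s) (fun r => η (s + r) - η s) t := by
  unfold rbDissipation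
  have hzc := continuous_rbFlow hU hV hk₁ hk₂ hγ Λ N x hη
  set g : ℝ → ℝ := fun r => (P.rbFlow Λ N x η r).2.1 ^ 2 + (P.rbFlow Λ N x η r).2.2 ^ 2 with hg
  have hc : Continuous g :=
    ((continuous_fst.comp (continuous_snd.comp hzc)).pow 2).add
      ((continuous_snd.comp (continuous_snd.comp hzc)).pow 2)
  rw [← mul_add]
  congr 1
  rw [← intervalIntegral.integral_add_adjacent_intervals (hc.intervalIntegrable 0 s)
    (hc.intervalIntegrable s (s + t))]
  congr 1
  have hsub : ∫ r in s..s + t, g r = ∫ u in (0 : ℝ)..t, g (s + u) := by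
    rw [intervalIntegral.integral_comp_add_left g s]
    simp
  rw [hsub]
  refine intervalIntegral.integral_congr fun u hu => ?_
  rw [uIcc_of_le ht] at hu
  simp only [hg]
  rw [rbFlow_add hU hV hk₁ hk₂ hγ Λ N x hη hs hu.1]

/-! ### Measurable dependence on a parametrised start and noise -/

/-- The flow depends measurably on a measurably parametrised start and reservoir noise path.
[folklore] -/
theorem measurable_rbFlow {Ω : Type*} {mΩ : MeasurableSpace Ω} {X : Ω → RBPhaseSpace N}
    (hX : Measurable X) {H : Ω → ℝ → ℝ × ℝ} (hHc : ∀ w, Continuous (H w))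
    (hHm : ∀ t, Measurable fun w => H w t) (t : ℝ) :
    Measurable fun w => P.rbFlow Λ N (X w) (H w) t := by
  unfold rbFlow
  exact (P.rbConfinedDrift hU hV hk₁ hk₂ hγ Λ N).measurable_flow hX
    (fun w => continuous_zero_prod (hHc w)) (fun w s => zero_prod_apply_mem_rbNoise (H w) s)
    (fun s => measurable_const.prodMk (hHm s)) t

/-- **The dissipation functional depends measurably on a measurably parametrised start and noise
path.** [folklore] -/
theorem measurable_rbDissipation {Ω : Type*} {mΩ : MeasurableSpace Ω} {X : Ω → RBPhaseSpace N}
    (hX : Measurable X) {H : Ω → ℝ → ℝ × ℝ} (hHc : ∀ w, Continuous (H w))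
    (hHm : ∀ t, Measurable fun w => H w t) (t : ℝ) :
    Measurable fun w => P.rbDissipation Λ N (X w) (H w) t := by
  unfold rbDissipation
  refine Measurable.const_mul ?_ _
  have hflow := fun s => measurable_rbFlow hU hV hk₁ hk₂ hγ Λ N hX hHc hHm s
  refine measurable_intervalIntegral_of_continuous_of_measurable (fun w => ?_) (fun s => ?_) t
  · have hzc := continuous_rbFlow hU hV hk₁ hk₂ hγ Λ N (X w) (hHc w)
    exact ((continuous_fst.comp (continuous_snd.comp hzc)).pow 2).add
      ((continuous_snd.comp (continuous_snd.comp hzc)).pow 2)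
  · exact ((measurable_fst.comp (measurable_snd.comp (hflow s))).pow_const 2).add
      ((measurable_snd.comp (measurable_snd.comp (hflow s))).pow_const 2)

/-- **The work of the noise depends measurably on a measurably parametrised start and noise
path.** [folklore] -/
theorem measurable_rbNoiseWork {Ω : Type*} {mΩ : MeasurableSpace Ω} {X : Ω → RBPhaseSpace N}
    (hX : Measurable X) {H : Ω → ℝ → ℝ × ℝ} (hHc : ∀ w, Continuous (H w))
    (hHm : ∀ t, Measurable fun w => H w t) (t : ℝ) :
    Measurable fun w => P.rbNoiseWork Λ N (X w) (H w) t := by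
  unfold rbNoiseWork
  have hflow := fun s => measurable_rbFlow hU hV hk₁ hk₂ hγ Λ N hX hHc hHm s
  have hYc : Continuous (P.rbDrift Λ N) := (P.contDiff_rbDrift hU.1 hV.1 Λ N).continuous
  have hH1 : ∀ s, Measurable fun w => (H w s).1 := fun s => measurable_fst.comp (hHm s)
  have hH2 : ∀ s, Measurable fun w => (H w s).2 := fun s => measurable_snd.comp (hHm s)
  refine Measurable.add ((Measurable.sub ?_ ?_).add ?_) ((Measurable.sub ?_ ?_).add ?_)
  · exact ((measurable_fst.comp (measurable_snd.comp (hflow t))).sub (hH1 t)).mul (hH1 t)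
  · refine measurable_intervalIntegral_of_continuous_of_measurable (fun w => ?_) (fun s => ?_) t
    · have hzc := continuous_rbFlow hU hV hk₁ hk₂ hγ Λ N (X w) (hHc w)
      exact (continuous_fst.comp (hHc w)).mul
        (continuous_fst.comp (continuous_snd.comp (hYc.comp hzc)))
    · exact (hH1 s).mul (measurable_fst.comp (measurable_snd.comp
        (hYc.measurable.comp (hflow s))))
  · exact ((hH1 t).pow_const 2).div_const 2
  · exact ((measurable_snd.comp (measurable_snd.comp (hflow t))).sub (hH2 t)).mul (hH2 t)
  · refine measurable_intervalIntegral_of_continuous_of_measurable (fun w => ?_) (fun s => ?_) t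
    · have hzc := continuous_rbFlow hU hV hk₁ hk₂ hγ Λ N (X w) (hHc w)
      exact (continuous_snd.comp (hHc w)).mul
        (continuous_snd.comp (continuous_snd.comp (hYc.comp hzc)))
    · exact (hH2 s).mul (measurable_snd.comp (measurable_snd.comp
        (hYc.measurable.comp (hflow s))))
  · exact ((hH2 t).pow_const 2).div_const 2

end OscillatorChain

end Identity

end Literature.MathematicalPhysics.KineticTheory.HeatConduction

end
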